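import Summits.QuantumFields.YangMills.Theses.ThermalDescent
import Summits.QuantumFields.YangMills.Theorems.ThermalDescentCornerCov
import Summits.QuantumFields.YangMills.Theorems.ThermalDescentTorusDictionary

/-!
# BC3 birth skeleton — crux `TransportIdentity` (stmt-QuantumFields-27342, child of `HypercubeSeam` 26515) of route `ThermalDescent` (rev 5)

Ideator ym-idea-6 g5, 2026-08-28.  Two registered stubs and the kernel-checked composition
`TransportIdentity_of : ThermalDescent.TransportIdentity` (uses exactly `stub_dictionary`, `stub_cornerCov`).
UPDATE 2026-08-28T11:40Z: both stubs are now theorems of the tree (`ThermalDescentTorusDictionary.stub_dictionary` p629242,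
`ThermalDescentCornerCov.stub_cornerCov` p628113) — this file has no `sorry`; the crux is landed as
`Theorems/ThermalDescentTransportIdentity.lean :: thermalDescent_transportIdentity`.
Currency = the items' verbatim `let`-chain (`P = 2L+1`, time = last `Fin` coordinate, centred coordinates `cc`, `posE` time-first,
`Cov_P(F,F') = E_P[FF'] − E_P[F]E_P[F']`, `refl` = reflection in the site plane `t = 0`, `B_f` = smeared action density, `D_f` = electric
discrepancy with the electric plaquettes `Ael` hung one unit lower).

* `stub_dictionary` (M, shared currency with `SeamFromMoments` 27002 — prove once, cite twice): the TORUS DICTIONARY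
  `Q2 G r β L s f g = Cov_P(B_f, B_g)` for all Schwartz `f, g`, all real `β, s`, `L ≥ 1`: NT's `Q2` (`box 4 L` / `torusLift (2L+1)` /
  `wilsonMeasure` / `dens`, time = coordinate 0, `Fin 4 → ZMod (2L+1)` sites) is the double sum of site–site covariances, i.e. by bilinearity
  the covariance of the smeared densities; the measurable equivalence of link configurations induced by `ZMod P ≃ Fin P` and the axis
  permutation `(0 1 2 3) ↦ (3 0 1 2)` pushes the normalised Wilson measure to `w/Z · ∏ dHaar` (same plaquette set, same action — compare
  `wilsonFinTorusPartition_eq_inline`) and carries `dens x` to `A x`, `f (s • siteToE x)` to `f (s • posE x)`.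
* `stub_cornerCov` (M, the load-bearing literal match): EXACT REFLECTION OF THE CORNER DENSITY inside covariances against any continuous
  `H`: `Cov_P(B_{θv}, H) = Cov_P(B_v ∘ refl, H) + Cov_P(D_v ∘ refl, H)` under the window hypotheses (`0 < s`, `0 < δ₁`,
  `tsupport v ⊆ {δ₁ < y₀ < δ₂}`, `δ₂ + s ≤ sL`).  Content: pointwise `B_{θv} = (B_v + D_v) ∘ refl` — `(θv)(s·posE x) = v(s·posE x̄)` with
  `x̄` the time-reflected site; spatial plaquettes of `U` at `x̄` are those of `refl U` at `x`; the temporal plaquette of `U` based at `x̄`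
  is the inverse of a cyclic conjugate of the temporal plaquette of `refl U` based ONE UNIT BELOW `x` (same `Re tr` for unitary `r.ρ`), which
  is `Ael`; re-indexing the electric sum by one time unit produces `D_v` (no wrap-around: `v` vanishes unless `δ₁/s < |cc t| < δ₂/s ≤ L−1`)
  — then bilinearity of `Cov` in the first argument (linearity of the integral; everything is continuous on a compact space).
  Tree models: `ActionDensityTimeReflection.plaquetteObs_zero_cfgReflect_of_ne/_zero_zero_cfgReflect`, `torusDensity_timeReflect`.

Composition: `Q2(θv, v) = Cov(B_{θv}, B_v)` (dictionary at `f = θv`, `g = v`) `= Cov(B_v∘refl, B_v) + Cov(D_v∘refl, B_v) = Qrp + Cov(D∘refl, B)`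
(corner reflection at `H = B_v`, continuous).  Per-stub probes: neither stub is the crux (each is one half of it) nor NT (finite-lattice identities).
No summit, leg or spine crux is proved here; NT stays open.
-/

set_option autoImplicit false
set_option maxHeartbeats 800000
set_option linter.unusedVariables false

namespace Summit.QuantumFields.YangMills.Cruxes.TransportIdentity.Birth

open MeasureTheory

/-- **stub_dictionary** (M): the torus dictionary `Q2 G r β L s f g = Cov_P(B_f, B_g)`, `P = 2L+1`. -/
theorem stub_dictionary :
    ∀ (G : Type) [Group G] [TopologicalSpace G] [IsTopologicalGroup G] [CompactSpace G], Literature.MathematicalPhysics.QuantumFieldTheory.IsCompactSimpleLieGroup G → letI : MeasurableSpace G := borel G; haveI : BorelSpace G := ⟨rfl⟩; ∀ (r : Literature.MathematicalPhysics.QuantumFieldTheory.LatticeRep G), let St : ℕ → ℕ → Type := fun S T => Literature.MathematicalPhysics.QuantumFieldTheory.FinTorusSite S S S T; let Cfg : ℕ → ℕ → Type := fun S T => Literature.MathematicalPhysics.QuantumFieldTheory.FinTorusSite S S S T × Fin 4 → G; let cc : (n : ℕ) → Fin n → ℤ := fun n i => if 2 * i.val < n then (i.val : ℤ) else (i.val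 : ℤ) - n; let posE : (S T : ℕ) → St S T → EuclideanSpace ℝ (Fin 4) := fun S T x => Literature.MathematicalPhysics.QuantumLattice.siteToE (d := 4) ![cc T x.2.2.2, cc S x.1, cc S x.2.1, cc S x.2.2.1]; let P : (S T : ℕ) → St S T → Fin 4 → Fin 4 → Cfg S T → ℝ := fun _ _ x i j U => (r.ρ (Literature.MathematicalPhysics.QuantumFieldTheory.finTorusPlaquette U x i j)).trace.re; let A : (S T : ℕ) → St S T → Cfg S T → ℝ := fun S T x U => ∑ q : {q : Fin 4 × Fin 4 // q.1 < q.2}, P S T x q.1.1 q.1.2 U; let Ael : (S T : ℕ) → St S T → Cfg S T → ℝ := fun S T x U => ∑ i : Fin 3, P S T x (Fin.castSucc i) (Fin.last 3) U; let w : ℝ → (S T : ℕ) → Cfg S T → ℝ := fun β S T U => Real.exp (-β * ∑ x : St S T, ∑ q : {q : Fin 4 × Fin 4 // q.1 < q.2}, ((r.N : ℝ) - P S T x q.1.1 q.1.2 U)); let E : ℝ → (S T : ℕ) → (Cfg S T → ℝ) → ℝ := fun β S T F => (∫ U : Literature.MathematicalPhysics.QuantumFieldTheory.FinTorusSite S S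 S T × Fin 4 → G, F U * w β S T U ∂MeasureTheory.Measure.pi (fun _ => Literature.MathematicalPhysics.QuantumFieldTheory.haarProbability G)) / Literature.MathematicalPhysics.QuantumFieldTheory.wilsonFinTorusPartition r.ρ β S S S T; let Cov : ℝ → (S T : ℕ) → (Cfg S T → ℝ) → (Cfg S T → ℝ) → ℝ := fun β S T F F' => E β S T (fun U => F U * F' U) - E β S T F * E β S T F'; let refl : (S T : ℕ) → Cfg S T → Cfg S T := fun _ T U e => if e.2 = Fin.last 3 then (U ((e.1.1, e.1.2.1, e.1.2.2.1, Fin.rev e.1.2.2.2), Fin.last 3))⁻¹ else U ((e.1.1, e.1.2.1, e.1.2.2.1, ⟨(T - e.1.2.2.2.val) % T, Nat.mod_lt _ e.1.2.2.2.pos⟩), e.2); let B : (S T : ℕ) → ℝ → SchwartzMap (EuclideanSpace ℝ (Fin 4)) ℝ → Cfg S T → ℝ := fun S T s f U => ∑ x : St S T, f (s • posE S T x) * A S T x U; let Qrp : ℝ → (S T : ℕ) → ℝ → SchwartzMap (EuclideanSpace ℝ (Fin 4)) ℝ → ℝ := fun β S T s f => Cov β S T (fun U => B S T s f (refl S T U))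 (B S T s f); let D : (S T : ℕ) → ℝ → SchwartzMap (EuclideanSpace ℝ (Fin 4)) ℝ → Cfg S T → ℝ := fun S T s f U => ∑ x : St S T, (f (s • posE S T x + s • EuclideanSpace.single (0 : Fin 4) (1 : ℝ)) - f (s • posE S T x)) * Ael S T x U; let Drp : ℝ → (S T : ℕ) → ℝ → SchwartzMap (EuclideanSpace ℝ (Fin 4)) ℝ → ℝ := fun β S T s f => Cov β S T (fun U => D S T s f (refl S T U)) (D S T s f); ∀ (β : ℝ) (L : ℕ) (s : ℝ) (f g : SchwartzMap (EuclideanSpace ℝ (Fin 4)) ℝ), 1 ≤ L → Summit.QuantumFields.YangMills.Cruxes.OSLegsFromFemtoAndGap.DlrCollarTransfer.Q2 G r β L s f g = Cov β (2 * L + 1) (2 * L + 1) (B (2 * L + 1) (2 * L + 1) s f) (B (2 * L + 1) (2 * L + 1) s g) :=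
  Summit.QuantumFields.YangMills.Theorems.ThermalDescentTorusDictionary.stub_dictionary

/-- **stub_cornerCov** (M): exact reflection of the corner density inside covariances,
`Cov_P(B_θv, H) = Cov_P(B_v ∘ refl, H) + Cov_P(D_v ∘ refl, H)` for continuous `H`. -/
theorem stub_cornerCov :
    ∀ (G : Type) [Group G] [TopologicalSpace G] [IsTopologicalGroup G] [CompactSpace G], Literature.MathematicalPhysics.QuantumFieldTheory.IsCompactSimpleLieGroup G → letI : MeasurableSpace G := borel G; haveI : BorelSpace G := ⟨rfl⟩; ∀ (r : Literature.MathematicalPhysics.QuantumFieldTheory.LatticeRep G), let St : ℕ → ℕ → Type := fun S T => Literature.MathematicalPhysics.QuantumFieldTheory.FinTorusSite S S S T; let Cfg : ℕ → ℕ → Type := fun S T => Literature.MathematicalPhysics.QuantumFieldTheory.FinTorusSite S S S T × Fin 4 → G; let cc : (n : ℕ) → Fin n → ℤ := fun n i => if 2 * i.val < n then (i.val : ℤ) else (i.val : ℤ) - n; let posE : (S T : ℕ) → St S T → EuclideanSpace ℝ (Fin 4) := fun S T x => Literature.MathematicalPhysics.QuantumLattice.siteToE (d := 4) ![cc T x.2.2.2,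 cc S x.1, cc S x.2.1, cc S x.2.2.1]; let P : (S T : ℕ) → St S T → Fin 4 → Fin 4 → Cfg S T → ℝ := fun _ _ x i j U => (r.ρ (Literature.MathematicalPhysics.QuantumFieldTheory.finTorusPlaquette U x i j)).trace.re; let A : (S T : ℕ) → St S T → Cfg S T → ℝ := fun S T x U => ∑ q : {q : Fin 4 × Fin 4 // q.1 < q.2}, P S T x q.1.1 q.1.2 U; let Ael : (S T : ℕ) → St S T → Cfg S T → ℝ := fun S T x U => ∑ i : Fin 3, P S T x (Fin.castSucc i) (Fin.last 3) U; let w : ℝ → (S T : ℕ) → Cfg S T → ℝ := fun β S T U => Real.exp (-β * ∑ x : St S T, ∑ q : {q : Fin 4 × Fin 4 // q.1 < q.2}, ((r.N : ℝ) - P S T x q.1.1 q.1.2 U)); let E : ℝ → (S T : ℕ) → (Cfg S T → ℝ) → ℝ := fun β S T F => (∫ U : Literature.MathematicalPhysics.QuantumFieldTheory.FinTorusSite S S S T × Fin 4 → G, F U * w β S T U ∂MeasureTheory.Measure.pi (fun _ => Literature.MathematicalPhysics.QuantumFieldTheory.haarProbability G)) / Literature.MathematicalPhysics.QuantumFieldTheory.wilsonFinTorusPartition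 r.ρ β S S S T; let Cov : ℝ → (S T : ℕ) → (Cfg S T → ℝ) → (Cfg S T → ℝ) → ℝ := fun β S T F F' => E β S T (fun U => F U * F' U) - E β S T F * E β S T F'; let refl : (S T : ℕ) → Cfg S T → Cfg S T := fun _ T U e => if e.2 = Fin.last 3 then (U ((e.1.1, e.1.2.1, e.1.2.2.1, Fin.rev e.1.2.2.2), Fin.last 3))⁻¹ else U ((e.1.1, e.1.2.1, e.1.2.2.1, ⟨(T - e.1.2.2.2.val) % T, Nat.mod_lt _ e.1.2.2.2.pos⟩), e.2); let B : (S T : ℕ) → ℝ → SchwartzMap (EuclideanSpace ℝ (Fin 4)) ℝ → Cfg S T → ℝ := fun S T s f U => ∑ x : St S T, f (s • posE S T x) * A S T x U; let Qrp : ℝ → (S T : ℕ) → ℝ → SchwartzMap (EuclideanSpace ℝ (Fin 4)) ℝ → ℝ := fun β S T s f => Cov β S T (fun U => B S T s f (refl S T U)) (B S T s f); let D : (S T : ℕ) → ℝ → SchwartzMap (EuclideanSpace ℝ (Fin 4)) ℝ → Cfg S T → ℝ := fun S T s f U => ∑ x : St S T, (f (s • posE S T x + s • EuclideanSpace.single (0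 : Fin 4) (1 : ℝ)) - f (s • posE S T x)) * Ael S T x U; let Drp : ℝ → (S T : ℕ) → ℝ → SchwartzMap (EuclideanSpace ℝ (Fin 4)) ℝ → ℝ := fun β S T s f => Cov β S T (fun U => D S T s f (refl S T U)) (D S T s f); ∀ (β : ℝ) (L : ℕ) (s : ℝ) (v : SchwartzMap (EuclideanSpace ℝ (Fin 4)) ℝ) (δ₁ δ₂ : ℝ), 1 ≤ L → 0 < s → 0 < δ₁ → tsupport v ⊆ {y : EuclideanSpace ℝ (Fin 4) | δ₁ < y 0 ∧ y 0 < δ₂} → δ₂ + s ≤ s * L → ∀ (H : (Literature.MathematicalPhysics.QuantumFieldTheory.FinTorusSite (2 * L + 1) (2 * L + 1) (2 * L + 1) (2 * L + 1) × Fin 4 → G) → ℝ), Continuous H → Cov β (2 * L + 1) (2 * L + 1) (B (2 * L + 1) (2 * L + 1) s (Literature.MathematicalPhysics.QuantumLattice.thetaTest 4 v)) H = Cov β (2 * L + 1) (2 * L + 1) (fun U => B (2 * L + 1) (2 * L + 1) s v (refl (2 * L + 1) (2 * L + 1) U)) H + Cov β (2 * L + 1) (2 * L + 1) (fun U => D (2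 * L + 1) (2 * L + 1) s v (refl (2 * L + 1) (2 * L + 1) U)) H :=
  Summit.QuantumFields.YangMills.Theorems.ThermalDescentCornerCov.stub_cornerCov

/-- **Composition** (kernel-checked, no sorry): `TransportIdentity` from the two stubs. -/
theorem TransportIdentity_of :
    Summit.QuantumFields.YangMills.Theses.ThermalDescent.TransportIdentity := by
  intro G _ _ _ _ hG r
  dsimp only
  intro β L s v δ₁ δ₂ hβ hL hs hδ₁ hsupp hsz
  have h1 := stub_dictionary G hG r β L s (Literature.MathematicalPhysics.QuantumLattice.thetaTest 4 v) v hL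
  dsimp only at h1
  rw [h1]
  have hU : ∀ l : Literature.MathematicalPhysics.QuantumFieldTheory.FinTorusSite (2 * L + 1) (2 * L + 1) (2 * L + 1) (2 * L + 1) × Fin 4,
      Continuous fun U : (Literature.MathematicalPhysics.QuantumFieldTheory.FinTorusSite (2 * L + 1) (2 * L + 1) (2 * L + 1) (2 * L + 1) × Fin 4 → G) => U l := fun l => continuous_apply l
  have hpl : ∀ (x : Literature.MathematicalPhysics.QuantumFieldTheory.FinTorusSite (2 * L + 1) (2 * L + 1) (2 * L + 1) (2 * L + 1)) (μ ν : Fin 4),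
      Continuous fun U : (Literature.MathematicalPhysics.QuantumFieldTheory.FinTorusSite (2 * L + 1) (2 * L + 1) (2 * L + 1) (2 * L + 1) × Fin 4 → G) =>
        Literature.MathematicalPhysics.QuantumFieldTheory.finTorusPlaquette U x μ ν := fun x μ ν =>
    (((hU _).mul (hU _)).mul (hU _).inv).mul (hU _).inv
  have htr : Continuous fun g : G => (r.ρ g).trace.re :=
    Complex.continuous_re.comp (Continuous.matrix_trace r.continuous)
  have h2 := stub_cornerCov G hG r β L s v δ₁ δ₂ hL hs hδ₁ hsupp hsz
  dsimp only at h2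
  refine h2 _ ?_
  exact continuous_finsetSum _ fun x _ =>
    continuous_const.mul (continuous_finsetSum _ fun q _ => htr.comp (hpl x _ _))

end Summit.QuantumFields.YangMills.Cruxes.TransportIdentity.Birth
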